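import Summits.AnomalousDissipation.AnomalousDissipation.Theorems.SawtoothPulseCascadeK1LocalisedCascadePhaseABOsc
import Summits.AnomalousDissipation.AnomalousDissipation.Theorems.SawtoothPulseCascadeK1LocalisedCascadeShellChain

/-!
# K1loc — THE SHELL CHAIN, NUMERIC FORM, OSCILLATORY GRADE

Prover lane on the crux `K1LocalisedCascade` (stmt-AnomalousDissipation-19491), route `SawtoothPulseCascade`
(S-B/S-C assembly seat; the LEDGER ASSEMBLY, numeric layer, Osc grade; companion of `…ShellChain`).  The shell escalation
`√A_{j₁+n}(Y) ≤ (1+γ)^{2j₁}/Y + Σ_{i<n} ω_{j₁+i}(Y)` (κ = 1, `…LedgerClassChain.sqrt_shell_escalation_step` +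
`sqrt_le_escalate_cap_of_floor`) with the per-phase losses `ω_i = √J_A(i) + √J_B(i) + √f_A(i) + √f_B(i)` of the OSCILLATORY
steps `…PhaseABOsc.shell_vstep_osc_le` / `shallow_hstep_osc_le` (constants `r* = 37/11, A* = 7, D₀ = 2⌊Y/2⌋` and
`r* = 49/23, A* = 13/3, D₀ = 3Y`).  The only hypotheses are the zone-depth conditions `M·δ_i < π/2` of the two steps for all `i`.
No definitions; no statement about the crux. [cite: Grafakos2014, Prop. 3.1.2 (5), Prop. 3.2.7 (3), §3.1.3] [problem: turb]
-/

-- `Summit.<Summit>.<Problem>`: single-conjunct summit, the duplicate namespace segment is deliberate.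
set_option linter.dupNamespace false

noncomputable section

namespace Summit.AnomalousDissipation.AnomalousDissipation.Theorems.SawtoothPulseCascade.K1Window

open MeasureTheory Set Filter Topology UnitAddTorus Function Complex Metric
open scoped Real ENNReal
open Literature.Analysis Literature.Analysis.FunctionSpaces Literature.Analysis.FunctionSpaces.Torus Literature.Analysis.FluidPDE
open Literature.Analysis.FluidPDE.ShearStage
open Literature.Analysis.FluidPDE.SawtoothCascade Literature.Analysis.FluidPDE.SawtoothCascade.CascadeParams
open Summit.AnomalousDissipation.AnomalousDissipation.Theorems.SawtoothPulseCascade.K1Start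
open Summit.AnomalousDissipation.AnomalousDissipation.Theorems.SawtoothPulseCascade.K1Flat
open Summit.AnomalousDissipation.AnomalousDissipation.Theorems.SawtoothPulseCascade.K1Ledger.From

section Cascade

variable (P : CascadeParams)

set_option maxHeartbeats 400000 in
/-- **THE SHELL CHAIN, NUMERIC FORM** (see the file header): for `Y ≥ 12`, `ε > 0`, every `j₁, n`,
`√A_{j₁+n}(Y) ≤ (1+γ)^{2j₁}/Y + Σ_{i<n} ω_{j₁+i}(Y)` with the explicit `ω` of `…PhaseABOsc`; the only hypotheses are the
zone-depth conditions `M·δ_i < π/2` of the two steps for all `i`. [cite: Grafakos2014, Prop. 3.1.2 (5), Prop. 3.2.7 (3), §3.1.3] -/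
theorem sqrt_shell_le_far_add_sum_osc (hγ : P.γ = 8) (hδ₀ : 0 < P.δ₀) (hd : P.d = 2) (hN₀ : P.N₀ = 1) (hρN : P.ρN = 2)
    (a b : ℕ → UnitAddTorus (Fin 2) → ℝ) (has : ∀ j, IsSmooth (a j)) (h0 : a 0 = datum)
    (hb : ∀ j, b j = a j ∘ shearMap 0 1 (amp ⟨P.U j, P.U_periodic j, P.contDiff_U (P.δ_pos hδ₀ (by rw [hd]; norm_num) j)⟩ P.γ))
    (hab : ∀ j, a (j + 1) = b j ∘ shearMap 1 0 (amp ⟨P.U j, P.U_periodic j, P.contDiff_U (P.δ_pos hδ₀ (by rw [hd]; norm_num) j)⟩ P.γ))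
    {Y : ℕ} (hY : 12 ≤ Y) {ε : ℝ} (hε : 0 < ε)
    (hMδA : ∀ i : ℕ, max 1 (Real.sqrt (2 * Real.log (1 / (ε / (7 * π * 8 * 2 ^ 20 * ((Y / 2 : ℕ) : ℝ)) * (1 / 64) ^ i)))) * P.δ i < π / 2)
    (hMδB : ∀ i : ℕ, max 1 (Real.sqrt (2 * Real.log (1 / (ε / (13 / 3 * π * 8 * 2 ^ 20 * (Y : ℝ)) * (1 / 64) ^ i)))) * P.δ i < π / 2)
    (n j₁ : ℕ) :
    Real.sqrt (∑' k : Fin 2 → ℤ, (if (Y : ℤ) ≤ |k 0| ∧ ((1 : ℕ) : ℤ) * |k 0| ≤ ((2 : ℕ) : ℤ) * |k 1| then (1 : ℝ) else 0) *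
        ‖mFourierCoeff (fun x => (a (j₁ + n) x : ℂ)) k‖ ^ 2) ≤
      (1 + P.γ) ^ (2 * j₁) / (Y : ℝ) +
        ∑ i ∈ Finset.range n,
          (Real.sqrt (3 * (37 / 11) ^ 2 *
            (4 / 3 * ε ^ 2 + 4 / 3 * (2 * 2 ^ (j₁ + i) / (π * (2 * ((Y / 2 : ℕ) : ℝ)))) ^ 2 + 8 * 2 ^ (j₁ + i) * 7 / (π * (2 * ((Y / 2 : ℕ) : ℝ))) +
              ((7 * (j₁ + i) + 20 : ℕ) : ℝ) * (8 * 2 ^ (j₁ + i) * 7 ^ 2 *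
                Real.sqrt (4 * (max 1 (Real.sqrt (2 * Real.log (1 / (ε / (7 * π * 8 * 2 ^ 20 * ((Y / 2 : ℕ) : ℝ)) * (1 / 64) ^ (j₁ + i))))) * P.δ (j₁ + i)) / (π * (2 * ((Y / 2 : ℕ) : ℝ)))) +
                8 * 7 ^ 2 * (max 1 (Real.sqrt (2 * Real.log (1 / (ε / (7 * π * 8 * 2 ^ 20 * ((Y / 2 : ℕ) : ℝ)) * (1 / 64) ^ (j₁ + i))))) * P.δ (j₁ + i)) / π))) +
            Real.sqrt (3 * (49 / 23) ^ 2 *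
            (4 / 3 * ε ^ 2 + 4 / 3 * (2 * 2 ^ (j₁ + i) / (π * (3 * (Y : ℝ)))) ^ 2 + 8 * 2 ^ (j₁ + i) * (13 / 3) / (π * (3 * (Y : ℝ))) +
              ((7 * (j₁ + i) + 20 : ℕ) : ℝ) * (8 * 2 ^ (j₁ + i) * (13 / 3) ^ 2 *
                Real.sqrt (4 * (max 1 (Real.sqrt (2 * Real.log (1 / (ε / (13 / 3 * π * 8 * 2 ^ 20 * (Y : ℝ)) * (1 / 64) ^ (j₁ + i))))) * P.δ (j₁ + i)) / (π * (3 * (Y : ℝ)))) +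
                8 * (13 / 3) ^ 2 * (max 1 (Real.sqrt (2 * Real.log (1 / (ε / (13 / 3 * π * 8 * 2 ^ 20 * (Y : ℝ)) * (1 / 64) ^ (j₁ + i))))) * P.δ (j₁ + i)) / π))) +
            Real.sqrt (((1 + P.γ) ^ (2 * (j₁ + i + 1)) / (((Y / 2) * 2 ^ (7 * (j₁ + i) + 20) : ℕ) : ℝ)) ^ 2) +
            Real.sqrt (((1 + P.γ) ^ (2 * (j₁ + i)) / ((Y * 2 ^ (7 * (j₁ + i) + 20) : ℕ) : ℝ)) ^ 2)) := by
  have hd' : 0 < P.d := by rw [hd]; norm_num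
  have hγ0 : 0 ≤ P.γ := by rw [hγ]; norm_num
  have hYr : (0 : ℝ) < (Y : ℝ) := by exact_mod_cast (lt_of_lt_of_le (by norm_num) hY : 0 < Y)
  -- the two classes as threshold-families (the threshold argument is ignored: everything happens at the fixed `Y`)
  set A : ℕ → ℝ → ℝ := fun i _ => ∑' k : Fin 2 → ℤ, (if (Y : ℤ) ≤ |k 0| ∧ ((1 : ℕ) : ℤ) * |k 0| ≤ ((2 : ℕ) : ℤ) * |k 1|
      then (1 : ℝ) else 0) * ‖mFourierCoeff (fun x => (a i x : ℂ)) k‖ ^ 2 with hA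
  set B : ℕ → ℝ → ℝ := fun i _ => ∑' k : Fin 2 → ℤ, (if (Y : ℤ) ≤ |k 0| ∧ ((1 : ℕ) : ℤ) * |k 1| ≤ ((2 : ℕ) : ℤ) * |k 0|
      then (1 : ℝ) else 0) * ‖mFourierCoeff (fun x => (b i x : ℂ)) k‖ ^ 2 with hB
  set wA : ℕ → ℝ := fun i => Real.sqrt (3 * (37 / 11) ^ 2 *
            (4 / 3 * ε ^ 2 + 4 / 3 * (2 * 2 ^ i / (π * (2 * ((Y / 2 : ℕ) : ℝ)))) ^ 2 + 8 * 2 ^ i * 7 / (π * (2 * ((Y / 2 : ℕ) : ℝ))) +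
              ((7 * i + 20 : ℕ) : ℝ) * (8 * 2 ^ i * 7 ^ 2 *
                Real.sqrt (4 * (max 1 (Real.sqrt (2 * Real.log (1 / (ε / (7 * π * 8 * 2 ^ 20 * ((Y / 2 : ℕ) : ℝ)) * (1 / 64) ^ i)))) * P.δ i) / (π * (2 * ((Y / 2 : ℕ) : ℝ)))) +
                8 * 7 ^ 2 * (max 1 (Real.sqrt (2 * Real.log (1 / (ε / (7 * π * 8 * 2 ^ 20 * ((Y / 2 : ℕ) : ℝ)) * (1 / 64) ^ i)))) * P.δ i) / π))) with hwA
  set wB : ℕ → ℝ := fun i => Real.sqrt (3 * (49 / 23) ^ 2 *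
            (4 / 3 * ε ^ 2 + 4 / 3 * (2 * 2 ^ i / (π * (3 * (Y : ℝ)))) ^ 2 + 8 * 2 ^ i * (13 / 3) / (π * (3 * (Y : ℝ))) +
              ((7 * i + 20 : ℕ) : ℝ) * (8 * 2 ^ i * (13 / 3) ^ 2 *
                Real.sqrt (4 * (max 1 (Real.sqrt (2 * Real.log (1 / (ε / (13 / 3 * π * 8 * 2 ^ 20 * (Y : ℝ)) * (1 / 64) ^ i)))) * P.δ i) / (π * (3 * (Y : ℝ)))) +
                8 * (13 / 3) ^ 2 * (max 1 (Real.sqrt (2 * Real.log (1 / (ε / (13 / 3 * π * 8 * 2 ^ 20 * (Y : ℝ)) * (1 / 64) ^ i)))) * P.δ i) / π))) with hwB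
  set fA : ℕ → ℝ := fun i => ((1 + P.γ) ^ (2 * (i + 1)) / (((Y / 2) * 2 ^ (7 * i + 20) : ℕ) : ℝ)) ^ 2 with hfA
  set fB : ℕ → ℝ := fun i => ((1 + P.γ) ^ (2 * i) / ((Y * 2 ^ (7 * i + 20) : ℕ) : ℝ)) ^ 2 with hfB
  have hI0 : ∀ (q : (Fin 2 → ℤ) → Prop) [DecidablePred q] (v : UnitAddTorus (Fin 2) → ℝ),
      0 ≤ ∑' k : Fin 2 → ℤ, (if q k then (1 : ℝ) else 0) * ‖mFourierCoeff (fun x => (v x : ℂ)) k‖ ^ 2 :=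
    fun q _ v => tsum_nonneg fun k => mul_nonneg (by split_ifs <;> norm_num) (sq_nonneg _)
  have h5 : ∀ i, 0 ≤ i → ∀ X : ℝ, (0 : ℝ) ≤ X → A (i + 1) X ≤ (wA i + Real.sqrt (B i (1 * X))) ^ 2 + fA i :=
    fun i _ X _ => shell_vstep_osc_le P hγ hδ₀ hd hN₀ hρN a b has h0 hb hab hY hε i (hMδA i)
  have h6 : ∀ i, 0 ≤ i → ∀ X : ℝ, (0 : ℝ) ≤ X → B i X ≤ (wB i + Real.sqrt (A i X)) ^ 2 + fB i :=
    fun i _ X _ => shallow_hstep_osc_le P hγ hδ₀ hd hN₀ hρN a b has h0 hb hab hY hε i (hMδB i)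
  have hstep := sqrt_shell_escalation_step (A := A) (B := B) (wA := wA) (wB := wB) (fA := fA) (fB := fB) (κ := 1)
    (mA := fun _ => 0) (mB := fun _ => 0) (j₀ := 0) zero_le_one h5 h6 (fun _ _ => by simp)
    (fun i _ => hI0 _ _) (fun i _ => hI0 _ _) (fun i => Real.sqrt_nonneg _) (fun i => Real.sqrt_nonneg _)
    (fun i => sq_nonneg _) (fun i => sq_nonneg _)
  -- the cap: the far tail of `a_{j₁}` at `Y`
  have hF : ∀ i, 0 ≤ i → ∀ X : ℝ, (0 : ℝ) ≤ X → A i X ≤ ((1 + P.γ) ^ (2 * i) / (Y : ℝ)) ^ 2 := by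
    intro i _ X _
    have hfar := tsum_far_iterate_le P hγ0 hδ₀ hd' a b has h0 hb hab i 0 (R := (Y : ℝ)) hYr
    refine le_trans ?_ hfar
    have hc : Summable fun k : Fin 2 → ℤ => ‖mFourierCoeff (fun x => (a i x : ℂ)) k‖ ^ 2 :=
      (SpectralLeakage.hasSum_sq_norm_mFourierCoeff_scalarL2Sq (has i).continuous).summable
    have hI : ∀ (q : (Fin 2 → ℤ) → Prop) [DecidablePred q],
        Summable fun k : Fin 2 → ℤ => (if q k then (1 : ℝ) else 0) * ‖mFourierCoeff (fun x => (a i x : ℂ)) k‖ ^ 2 := by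
      intro q _
      refine Summable.of_nonneg_of_le (fun k => mul_nonneg (by split_ifs <;> norm_num) (sq_nonneg _)) (fun k => ?_) hc
      exact mul_le_of_le_one_left (sq_nonneg _) (by split_ifs <;> norm_num)
    refine (hI _).tsum_le_tsum (fun k => indicator_mul_le_of_imp (fun h => ?_) (sq_nonneg _)) (hI _)
    have h1 : (Y : ℤ) ≤ |k 0| := h.1
    rw [← Int.cast_abs]
    exact_mod_cast h1
  have hmain := sqrt_le_escalate_cap_of_floor (A := A) (F := fun i _ => ((1 + P.γ) ^ (2 * i) / (Y : ℝ)) ^ 2)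
    (ω := fun i => wA i + wB i + Real.sqrt (fA i) + Real.sqrt (fB i)) (κ := 1) (m := fun _ => 0) (j₀ := 0) le_rfl
    (fun _ => le_rfl) (fun _ _ _ => le_rfl) hstep hF n j₁ (Nat.zero_le _) 0 le_rfl
  have hsq : Real.sqrt ((fun (i : ℕ) (_ : ℝ) => ((1 + P.γ) ^ (2 * i) / (Y : ℝ)) ^ 2) j₁ ((1 : ℝ) ^ n * 0)) =
      (1 + P.γ) ^ (2 * j₁) / (Y : ℝ) := by
    show Real.sqrt (((1 + P.γ) ^ (2 * j₁) / (Y : ℝ)) ^ 2) = _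
    exact Real.sqrt_sq (by positivity)
  rw [hsq] at hmain
  exact hmain

set_option maxHeartbeats 400000 in
/-- **THE SHELL CHAIN FROM PHASE `j₁`, NUMERIC FORM**: as `sqrt_shell_le_far_add_sum_osc`, but the zone-depth conditions are only
asked at the phases `i ≥ j₁` the chain visits (the thin tail starts its chains late, where `δ_i` is already small). For `Y ≥ 12`, `ε > 0`, every `j₁, n`,
`√A_{j₁+n}(Y) ≤ (1+γ)^{2j₁}/Y + Σ_{i<n} ω_{j₁+i}(Y)` with the explicit `ω` of `…PhaseABOsc`; the only hypotheses are the
zone-depth conditions `M·δ_i < π/2` of the two steps for all `i`. [cite: Grafakos2014, Prop. 3.1.2 (5), Prop. 3.2.7 (3), §3.1.3] -/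
theorem sqrt_shell_le_far_add_sum_osc_from (hγ : P.γ = 8) (hδ₀ : 0 < P.δ₀) (hd : P.d = 2) (hN₀ : P.N₀ = 1) (hρN : P.ρN = 2)
    (a b : ℕ → UnitAddTorus (Fin 2) → ℝ) (has : ∀ j, IsSmooth (a j)) (h0 : a 0 = datum)
    (hb : ∀ j, b j = a j ∘ shearMap 0 1 (amp ⟨P.U j, P.U_periodic j, P.contDiff_U (P.δ_pos hδ₀ (by rw [hd]; norm_num) j)⟩ P.γ))
    (hab : ∀ j, a (j + 1) = b j ∘ shearMap 1 0 (amp ⟨P.U j, P.U_periodic j, P.contDiff_U (P.δ_pos hδ₀ (by rw [hd]; norm_num) j)⟩ P.γ))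
    {Y : ℕ} (hY : 12 ≤ Y) {ε : ℝ} (hε : 0 < ε) (n j₁ : ℕ)
    (hMδA : ∀ i : ℕ, j₁ ≤ i → max 1 (Real.sqrt (2 * Real.log (1 / (ε / (7 * π * 8 * 2 ^ 20 * ((Y / 2 : ℕ) : ℝ)) * (1 / 64) ^ i)))) * P.δ i < π / 2)
    (hMδB : ∀ i : ℕ, j₁ ≤ i → max 1 (Real.sqrt (2 * Real.log (1 / (ε / (13 / 3 * π * 8 * 2 ^ 20 * (Y : ℝ)) * (1 / 64) ^ i)))) * P.δ i < π / 2)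
    :
    Real.sqrt (∑' k : Fin 2 → ℤ, (if (Y : ℤ) ≤ |k 0| ∧ ((1 : ℕ) : ℤ) * |k 0| ≤ ((2 : ℕ) : ℤ) * |k 1| then (1 : ℝ) else 0) *
        ‖mFourierCoeff (fun x => (a (j₁ + n) x : ℂ)) k‖ ^ 2) ≤
      (1 + P.γ) ^ (2 * j₁) / (Y : ℝ) +
        ∑ i ∈ Finset.range n,
          (Real.sqrt (3 * (37 / 11) ^ 2 *
            (4 / 3 * ε ^ 2 + 4 / 3 * (2 * 2 ^ (j₁ + i) / (π * (2 * ((Y / 2 : ℕ) : ℝ)))) ^ 2 + 8 * 2 ^ (j₁ + i) * 7 / (π * (2 * ((Y / 2 : ℕ) : ℝ))) +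
              ((7 * (j₁ + i) + 20 : ℕ) : ℝ) * (8 * 2 ^ (j₁ + i) * 7 ^ 2 *
                Real.sqrt (4 * (max 1 (Real.sqrt (2 * Real.log (1 / (ε / (7 * π * 8 * 2 ^ 20 * ((Y / 2 : ℕ) : ℝ)) * (1 / 64) ^ (j₁ + i))))) * P.δ (j₁ + i)) / (π * (2 * ((Y / 2 : ℕ) : ℝ)))) +
                8 * 7 ^ 2 * (max 1 (Real.sqrt (2 * Real.log (1 / (ε / (7 * π * 8 * 2 ^ 20 * ((Y / 2 : ℕ) : ℝ)) * (1 / 64) ^ (j₁ + i))))) * P.δ (j₁ + i)) / π))) +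
            Real.sqrt (3 * (49 / 23) ^ 2 *
            (4 / 3 * ε ^ 2 + 4 / 3 * (2 * 2 ^ (j₁ + i) / (π * (3 * (Y : ℝ)))) ^ 2 + 8 * 2 ^ (j₁ + i) * (13 / 3) / (π * (3 * (Y : ℝ))) +
              ((7 * (j₁ + i) + 20 : ℕ) : ℝ) * (8 * 2 ^ (j₁ + i) * (13 / 3) ^ 2 *
                Real.sqrt (4 * (max 1 (Real.sqrt (2 * Real.log (1 / (ε / (13 / 3 * π * 8 * 2 ^ 20 * (Y : ℝ)) * (1 / 64) ^ (j₁ + i))))) * P.δ (j₁ + i)) / (π * (3 * (Y : ℝ)))) +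
                8 * (13 / 3) ^ 2 * (max 1 (Real.sqrt (2 * Real.log (1 / (ε / (13 / 3 * π * 8 * 2 ^ 20 * (Y : ℝ)) * (1 / 64) ^ (j₁ + i))))) * P.δ (j₁ + i)) / π))) +
            Real.sqrt (((1 + P.γ) ^ (2 * (j₁ + i + 1)) / (((Y / 2) * 2 ^ (7 * (j₁ + i) + 20) : ℕ) : ℝ)) ^ 2) +
            Real.sqrt (((1 + P.γ) ^ (2 * (j₁ + i)) / ((Y * 2 ^ (7 * (j₁ + i) + 20) : ℕ) : ℝ)) ^ 2)) := by
  have hd' : 0 < P.d := by rw [hd]; norm_num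
  have hγ0 : 0 ≤ P.γ := by rw [hγ]; norm_num
  have hYr : (0 : ℝ) < (Y : ℝ) := by exact_mod_cast (lt_of_lt_of_le (by norm_num) hY : 0 < Y)
  -- the two classes as threshold-families (the threshold argument is ignored: everything happens at the fixed `Y`)
  set A : ℕ → ℝ → ℝ := fun i _ => ∑' k : Fin 2 → ℤ, (if (Y : ℤ) ≤ |k 0| ∧ ((1 : ℕ) : ℤ) * |k 0| ≤ ((2 : ℕ) : ℤ) * |k 1|
      then (1 : ℝ) else 0) * ‖mFourierCoeff (fun x => (a i x : ℂ)) k‖ ^ 2 with hA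
  set B : ℕ → ℝ → ℝ := fun i _ => ∑' k : Fin 2 → ℤ, (if (Y : ℤ) ≤ |k 0| ∧ ((1 : ℕ) : ℤ) * |k 1| ≤ ((2 : ℕ) : ℤ) * |k 0|
      then (1 : ℝ) else 0) * ‖mFourierCoeff (fun x => (b i x : ℂ)) k‖ ^ 2 with hB
  set wA : ℕ → ℝ := fun i => Real.sqrt (3 * (37 / 11) ^ 2 *
            (4 / 3 * ε ^ 2 + 4 / 3 * (2 * 2 ^ i / (π * (2 * ((Y / 2 : ℕ) : ℝ)))) ^ 2 + 8 * 2 ^ i * 7 / (π * (2 * ((Y / 2 : ℕ) : ℝ))) +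
              ((7 * i + 20 : ℕ) : ℝ) * (8 * 2 ^ i * 7 ^ 2 *
                Real.sqrt (4 * (max 1 (Real.sqrt (2 * Real.log (1 / (ε / (7 * π * 8 * 2 ^ 20 * ((Y / 2 : ℕ) : ℝ)) * (1 / 64) ^ i)))) * P.δ i) / (π * (2 * ((Y / 2 : ℕ) : ℝ)))) +
                8 * 7 ^ 2 * (max 1 (Real.sqrt (2 * Real.log (1 / (ε / (7 * π * 8 * 2 ^ 20 * ((Y / 2 : ℕ) : ℝ)) * (1 / 64) ^ i)))) * P.δ i) / π))) with hwA
  set wB : ℕ → ℝ := fun i => Real.sqrt (3 * (49 / 23) ^ 2 *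
            (4 / 3 * ε ^ 2 + 4 / 3 * (2 * 2 ^ i / (π * (3 * (Y : ℝ)))) ^ 2 + 8 * 2 ^ i * (13 / 3) / (π * (3 * (Y : ℝ))) +
              ((7 * i + 20 : ℕ) : ℝ) * (8 * 2 ^ i * (13 / 3) ^ 2 *
                Real.sqrt (4 * (max 1 (Real.sqrt (2 * Real.log (1 / (ε / (13 / 3 * π * 8 * 2 ^ 20 * (Y : ℝ)) * (1 / 64) ^ i)))) * P.δ i) / (π * (3 * (Y : ℝ)))) +
                8 * (13 / 3) ^ 2 * (max 1 (Real.sqrt (2 * Real.log (1 / (ε / (13 / 3 * π * 8 * 2 ^ 20 * (Y : ℝ)) * (1 / 64) ^ i)))) * P.δ i) / π))) with hwB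
  set fA : ℕ → ℝ := fun i => ((1 + P.γ) ^ (2 * (i + 1)) / (((Y / 2) * 2 ^ (7 * i + 20) : ℕ) : ℝ)) ^ 2 with hfA
  set fB : ℕ → ℝ := fun i => ((1 + P.γ) ^ (2 * i) / ((Y * 2 ^ (7 * i + 20) : ℕ) : ℝ)) ^ 2 with hfB
  have hI0 : ∀ (q : (Fin 2 → ℤ) → Prop) [DecidablePred q] (v : UnitAddTorus (Fin 2) → ℝ),
      0 ≤ ∑' k : Fin 2 → ℤ, (if q k then (1 : ℝ) else 0) * ‖mFourierCoeff (fun x => (v x : ℂ)) k‖ ^ 2 :=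
    fun q _ v => tsum_nonneg fun k => mul_nonneg (by split_ifs <;> norm_num) (sq_nonneg _)
  have h5 : ∀ i, j₁ ≤ i → ∀ X : ℝ, (0 : ℝ) ≤ X → A (i + 1) X ≤ (wA i + Real.sqrt (B i (1 * X))) ^ 2 + fA i :=
    fun i hi X _ => shell_vstep_osc_le P hγ hδ₀ hd hN₀ hρN a b has h0 hb hab hY hε i (hMδA i hi)
  have h6 : ∀ i, j₁ ≤ i → ∀ X : ℝ, (0 : ℝ) ≤ X → B i X ≤ (wB i + Real.sqrt (A i X)) ^ 2 + fB i :=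
    fun i hi X _ => shallow_hstep_osc_le P hγ hδ₀ hd hN₀ hρN a b has h0 hb hab hY hε i (hMδB i hi)
  have hstep := sqrt_shell_escalation_step (A := A) (B := B) (wA := wA) (wB := wB) (fA := fA) (fB := fB) (κ := 1)
    (mA := fun _ => 0) (mB := fun _ => 0) (j₀ := j₁) zero_le_one h5 h6 (fun _ _ => by simp)
    (fun i _ => hI0 _ _) (fun i _ => hI0 _ _) (fun i => Real.sqrt_nonneg _) (fun i => Real.sqrt_nonneg _)
    (fun i => sq_nonneg _) (fun i => sq_nonneg _)
  -- the cap: the far tail of `a_{j₁}` at `Y`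
  have hF : ∀ i, j₁ ≤ i → ∀ X : ℝ, (0 : ℝ) ≤ X → A i X ≤ ((1 + P.γ) ^ (2 * i) / (Y : ℝ)) ^ 2 := by
    intro i _ X _
    have hfar := tsum_far_iterate_le P hγ0 hδ₀ hd' a b has h0 hb hab i 0 (R := (Y : ℝ)) hYr
    refine le_trans ?_ hfar
    have hc : Summable fun k : Fin 2 → ℤ => ‖mFourierCoeff (fun x => (a i x : ℂ)) k‖ ^ 2 :=
      (SpectralLeakage.hasSum_sq_norm_mFourierCoeff_scalarL2Sq (has i).continuous).summable
    have hI : ∀ (q : (Fin 2 → ℤ) → Prop) [DecidablePred q],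
        Summable fun k : Fin 2 → ℤ => (if q k then (1 : ℝ) else 0) * ‖mFourierCoeff (fun x => (a i x : ℂ)) k‖ ^ 2 := by
      intro q _
      refine Summable.of_nonneg_of_le (fun k => mul_nonneg (by split_ifs <;> norm_num) (sq_nonneg _)) (fun k => ?_) hc
      exact mul_le_of_le_one_left (sq_nonneg _) (by split_ifs <;> norm_num)
    refine (hI _).tsum_le_tsum (fun k => indicator_mul_le_of_imp (fun h => ?_) (sq_nonneg _)) (hI _)
    have h1 : (Y : ℤ) ≤ |k 0| := h.1
    rw [← Int.cast_abs]
    exact_mod_cast h1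
  have hmain := sqrt_le_escalate_cap_of_floor (A := A) (F := fun i _ => ((1 + P.γ) ^ (2 * i) / (Y : ℝ)) ^ 2)
    (ω := fun i => wA i + wB i + Real.sqrt (fA i) + Real.sqrt (fB i)) (κ := 1) (m := fun _ => 0) (j₀ := j₁) le_rfl
    (fun _ => le_rfl) (fun _ _ _ => le_rfl) hstep hF n j₁ le_rfl 0 le_rfl
  have hsq : Real.sqrt ((fun (i : ℕ) (_ : ℝ) => ((1 + P.γ) ^ (2 * i) / (Y : ℝ)) ^ 2) j₁ ((1 : ℝ) ^ n * 0)) =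
      (1 + P.γ) ^ (2 * j₁) / (Y : ℝ) := by
    show Real.sqrt (((1 + P.γ) ^ (2 * j₁) / (Y : ℝ)) ^ 2) = _
    exact Real.sqrt_sq (by positivity)
  rw [hsq] at hmain
  exact hmain

end Cascade

end Summit.AnomalousDissipation.AnomalousDissipation.Theorems.SawtoothPulseCascade.K1Window
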